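import Mathlib
import Summits.KontsevichZagierPeriods.Zeta5Search.GHatThirdOrder
import Summits.KontsevichZagierPeriods.Zeta5Search.PadicFourthOrder
import Summits.KontsevichZagierPeriods.Zeta5Search.HarmonicPrimeToPThird
import HarnessLib

/-!
# ζ(5) search — the class invariants `φ_x`, `φ₂,x`, `φ₃,x`, `c₃,x` TO FOURTH ORDER (companions of `padicNorm_gHat_sub_fourth_le`)

Cell `pub-zeta5` (HONEST FRAMING: systematic search; no irrationality claim unless certified), gen-2 seat generation 15
(REPORT-gen2-g15 §3; item (G4) "companion transports" of REPORT-gen2-g14 §6).  One Taylor order beyond `GHatThirdOrder.lean`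
(`padicNorm_phi2Hat_sub_le`, `padicNorm_phiHat_sub_second_le`): for a residue class with base `x < p` and a class point `q = x + ℓp`
(window `b₀ < p²`, so every foreign difference `s − q` is a `p`-adic unit), with `φ₃ = phi3Expl` (`PadicFourthOrder.lean`):
* `padicNorm_phi3Expl_le_one`, `padicNorm_phi3Expl_sub_le` — `φ₃` is `p`-integral and CLASS-CONSTANT modulo `p`;
* `padicNorm_phi2Hat_sub_second_le` — **`φ₂,q ≡ φ₂,x + 2ℓp·φ₃,x (mod p²)`**;
* `padicNorm_phiHat_sub_third_le` — **`φ_q ≡ φ_x + ℓp·φ₂,x + ℓ²p²·φ₃,x (mod p³)`**;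
* `padicNorm_cubicExpl_sub_le` — the cubic Taylor coefficient **`c₃ = (φ³ − 3φφ₂ + 2φ₃)/6` is class-constant modulo `p`** (`p ≥ 5`).
The pointwise one-term expansions `1/(u+t)³ ≡ 1/u³ (p)`, `1/(u+t)² ≡ 1/u² − 2t/u³ (p²)`, `1/(u+t) ≡ 1/u − t/u² + t²/u³ (p³)` are
`padicNorm_div_cube_sub_le`, `padicNorm_div_sq_add_sub_le`, `padicNorm_div_add_sub_le₃` of `HarmonicPrimeToPThird.lean`.
Together with `padicNorm_gHat_sub_fourth_le` these are the transports used by the classwise fourth digit (W4)/(V4)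
(`SecondResidueLaw.FourthDigitW/V`, staged).  `p`-adic norms of rational numbers; nothing here concerns irrationality.
-/

noncomputable section

open Finset

namespace Summit.KontsevichZagierPeriods.Zeta5Search.SecondOrder

open Summit.KontsevichZagierPeriods.Zeta5Search.ClusterValuation
open Summit.KontsevichZagierPeriods.Zeta5Search.PadicSeries
open Summit.KontsevichZagierPeriods.Zeta5Search.CellA (padicNorm_sub_eq_one_of_mod_ne padicNorm_pow_eq padicNorm_p)

variable {p : ℕ} [hp : Fact p.Prime]

/-! ### `φ₃`: integrality and class-constancy modulo `p` -/

/-- **`φ₃,q` is `p`-integral** (`p` odd). -/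
theorem padicNorm_phi3Expl_le_one (b : ℕ → ℤ) (hp2 : p ≠ 2) (q : ℕ) : padicNorm p (phi3Expl b p q) ≤ 1 := by
  unfold phi3Expl
  refine (padicNorm.nonarchimedean (p := p)).trans (max_le ?_ ?_)
  · refine padicNorm.sum_le' (fun s hs => ?_) zero_le_one
    rw [padicNorm.div, padicNorm_pow_eq, padicNorm_sub_eq_one_of_mod_ne (mem_filter.1 hs).2, one_pow, div_one]
    exact padicNorm.of_int _
  · split_ifs with h
    · rw [padicNorm.div, padicNorm.one, padicNorm_pow_eq, padicNorm_centre_eq_one b hp2 h.2, one_pow, div_one]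
    · simp

/-- **`φ₃` is class-constant modulo `p`**: `‖φ₃,q − φ₃,x‖_p ≤ p⁻¹` for `q` in the class of `x < p`. -/
theorem padicNorm_phi3Expl_sub_le (b : ℕ → ℤ) (hp2 : p ≠ 2) {x q : ℕ} (hx : x < p) (hq : q ∈ classSet b p x) :
    padicNorm p (phi3Expl b p q - phi3Expl b p x) ≤ (p : ℚ) ^ (-(1 : ℤ)) := by
  have hqx : q % p = x % p := (mem_filter.1 hq).2
  obtain ⟨hqdec, ht⟩ := class_point_decomp b hx hq
  set t : ℚ := -(((q / p : ℕ) : ℚ) * p) with htdef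
  have hcen : CentreIn b p q ↔ CentreIn b p x := centreIn_iff_of_mem hq
  set S := (range ((b 0).toNat + 1)).filter (fun s => s % p ≠ x % p) with hS
  have hunit : ∀ s ∈ S, padicNorm p ((s : ℚ) - x) = 1 := fun s hs => padicNorm_sub_eq_one_of_mod_ne (mem_filter.1 hs).2
  have hsq : ∀ s : ℕ, ((s : ℚ) - q) = ((s : ℚ) - x) + t := by intro s; rw [hqdec, htdef]; ring
  have hφq : phi3Expl b p q = (∑ s ∈ S, (netExp b s : ℚ) / ((s : ℚ) - q) ^ 3)
      + (if ¬ (2 : ℤ) ∣ b 0 ∧ ¬ CentreIn b p q then 1 / (((b 0 : ℤ) : ℚ) / 2 - q) ^ 3 else 0) := by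
    rw [phi3Expl, hS, hqx]
  have hφx : phi3Expl b p x = (∑ s ∈ S, (netExp b s : ℚ) / ((s : ℚ) - x) ^ 3)
      + (if ¬ (2 : ℤ) ∣ b 0 ∧ ¬ CentreIn b p x then 1 / (((b 0 : ℤ) : ℚ) / 2 - x) ^ 3 else 0) := rfl
  have e : phi3Expl b p q - phi3Expl b p x =
      (∑ s ∈ S, ((netExp b s : ℚ) / ((s : ℚ) - q) ^ 3 - (netExp b s : ℚ) / ((s : ℚ) - x) ^ 3))
      + ((if ¬ (2 : ℤ) ∣ b 0 ∧ ¬ CentreIn b p q then 1 / (((b 0 : ℤ) : ℚ) / 2 - q) ^ 3 else 0)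
          - (if ¬ (2 : ℤ) ∣ b 0 ∧ ¬ CentreIn b p x then 1 / (((b 0 : ℤ) : ℚ) / 2 - x) ^ 3 else 0)) := by
    rw [hφq, hφx, sum_sub_distrib]; ring
  rw [e]
  refine (padicNorm.nonarchimedean (p := p)).trans (max_le ?_ ?_)
  · refine padicNorm.sum_le' (fun s hs => ?_) (zpow_p_nonneg _)
    rw [hsq s]
    exact padicNorm_div_cube_sub_le (padicNorm.of_int _) (hunit s hs) ht
  · by_cases h : ¬ (2 : ℤ) ∣ b 0 ∧ ¬ CentreIn b p q
    · have h' : ¬ (2 : ℤ) ∣ b 0 ∧ ¬ CentreIn b p x := ⟨h.1, fun hc => h.2 (hcen.2 hc)⟩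
      rw [if_pos h, if_pos h']
      have hc1 := padicNorm_centre_eq_one b hp2 h'.2
      have ec : (((b 0 : ℤ) : ℚ) / 2 - q) = (((b 0 : ℤ) : ℚ) / 2 - x) + t := by rw [hqdec, htdef]; ring
      rw [ec]
      exact padicNorm_div_cube_sub_le (by rw [padicNorm.one]) hc1 ht
    · have h' : ¬ (¬ (2 : ℤ) ∣ b 0 ∧ ¬ CentreIn b p x) := fun hc => h ⟨hc.1, fun hcc => hc.2 (hcen.1 hcc)⟩
      rw [if_neg h, if_neg h', sub_self, padicNorm.zero]; exact zpow_p_nonneg _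

/-! ### `φ₂` to second order: `φ₂,q ≡ φ₂,x + 2ℓp·φ₃,x (mod p²)` -/

/-- **`φ₂,q ≡ φ₂,x + 2ℓp·φ₃,x (mod p²)`** for `x < p` and `q = x + ℓp` in the class of `x` (`ℓ = q / p`). -/
theorem padicNorm_phi2Hat_sub_second_le (b : ℕ → ℤ) (hp2 : p ≠ 2) {x q : ℕ} (hx : x < p) (hq : q ∈ classSet b p x) :
    padicNorm p (phi2Hat b p q - (phi2Hat b p x + 2 * (((q / p : ℕ) : ℚ) * p) * phi3Expl b p x)) ≤ (p : ℚ) ^ (-(2 : ℤ)) := by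
  have hqx : q % p = x % p := (mem_filter.1 hq).2
  obtain ⟨hqdec, ht⟩ := class_point_decomp b hx hq
  set t : ℚ := -(((q / p : ℕ) : ℚ) * p) with htdef
  have hcen : CentreIn b p q ↔ CentreIn b p x := centreIn_iff_of_mem hq
  set S := (range ((b 0).toNat + 1)).filter (fun s => s % p ≠ x % p) with hS
  have hunit : ∀ s ∈ S, padicNorm p ((s : ℚ) - x) = 1 := fun s hs => padicNorm_sub_eq_one_of_mod_ne (mem_filter.1 hs).2
  have hsq : ∀ s : ℕ, ((s : ℚ) - q) = ((s : ℚ) - x) + t := by intro s; rw [hqdec, htdef]; ring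
  have hφq : phi2Hat b p q = (∑ s ∈ S, (netExp b s : ℚ) / ((s : ℚ) - q) ^ 2)
      + (if ¬ (2 : ℤ) ∣ b 0 ∧ ¬ CentreIn b p q then 1 / (((b 0 : ℤ) : ℚ) / 2 - q) ^ 2 else 0) := by
    rw [phi2Hat, hS, hqx]
  have hφx : phi2Hat b p x = (∑ s ∈ S, (netExp b s : ℚ) / ((s : ℚ) - x) ^ 2)
      + (if ¬ (2 : ℤ) ∣ b 0 ∧ ¬ CentreIn b p x then 1 / (((b 0 : ℤ) : ℚ) / 2 - x) ^ 2 else 0) := rfl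
  have hφ3x : phi3Expl b p x = (∑ s ∈ S, (netExp b s : ℚ) / ((s : ℚ) - x) ^ 3)
      + (if ¬ (2 : ℤ) ∣ b 0 ∧ ¬ CentreIn b p x then 1 / (((b 0 : ℤ) : ℚ) / 2 - x) ^ 3 else 0) := rfl
  have hℓt : 2 * (((q / p : ℕ) : ℚ) * p) = -(2 * t) := by rw [htdef]; ring
  rw [hℓt]
  have e : phi2Hat b p q - (phi2Hat b p x + -(2 * t) * phi3Expl b p x) =
      (∑ s ∈ S, ((netExp b s : ℚ) / ((s : ℚ) - q) ^ 2
          - ((netExp b s : ℚ) / ((s : ℚ) - x) ^ 2 - 2 * t * ((netExp b s : ℚ) / ((s : ℚ) - x) ^ 3))))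
      + ((if ¬ (2 : ℤ) ∣ b 0 ∧ ¬ CentreIn b p q then 1 / (((b 0 : ℤ) : ℚ) / 2 - q) ^ 2 else 0)
          - ((if ¬ (2 : ℤ) ∣ b 0 ∧ ¬ CentreIn b p x then 1 / (((b 0 : ℤ) : ℚ) / 2 - x) ^ 2 else 0)
              - 2 * t * (if ¬ (2 : ℤ) ∣ b 0 ∧ ¬ CentreIn b p x then 1 / (((b 0 : ℤ) : ℚ) / 2 - x) ^ 3 else 0))) := by
    rw [hφq, hφx, hφ3x, sum_sub_distrib, sum_sub_distrib, ← mul_sum]; ring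
  rw [e]
  refine (padicNorm.nonarchimedean (p := p)).trans (max_le ?_ ?_)
  · refine padicNorm.sum_le' (fun s hs => ?_) (zpow_p_nonneg _)
    rw [hsq s]
    exact padicNorm_div_sq_add_sub_le (padicNorm.of_int _) (hunit s hs) ht
  · by_cases h : ¬ (2 : ℤ) ∣ b 0 ∧ ¬ CentreIn b p q
    · have h' : ¬ (2 : ℤ) ∣ b 0 ∧ ¬ CentreIn b p x := ⟨h.1, fun hc => h.2 (hcen.2 hc)⟩
      rw [if_pos h, if_pos h', if_pos h']
      have hc1 := padicNorm_centre_eq_one b hp2 h'.2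
      have ec : (((b 0 : ℤ) : ℚ) / 2 - q) = (((b 0 : ℤ) : ℚ) / 2 - x) + t := by rw [hqdec, htdef]; ring
      rw [ec]
      exact padicNorm_div_sq_add_sub_le (by rw [padicNorm.one]) hc1 ht
    · have h' : ¬ (¬ (2 : ℤ) ∣ b 0 ∧ ¬ CentreIn b p x) := fun hc => h ⟨hc.1, fun hcc => hc.2 (hcen.1 hcc)⟩
      rw [if_neg h, if_neg h', if_neg h', mul_zero, sub_zero, sub_self, padicNorm.zero]; exact zpow_p_nonneg _

/-! ### `φ` to third order: `φ_q ≡ φ_x + ℓp·φ₂,x + ℓ²p²·φ₃,x (mod p³)` -/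

/-- **`φ_q ≡ φ_x + ℓp·φ₂,x + ℓ²p²·φ₃,x (mod p³)`** for `x < p` and `q = x + ℓp` in the class of `x` (`ℓ = q / p`). -/
theorem padicNorm_phiHat_sub_third_le (b : ℕ → ℤ) (hp2 : p ≠ 2) {x q : ℕ} (hx : x < p) (hq : q ∈ classSet b p x) :
    padicNorm p (phiHat b p q - (phiHat b p x + ((q / p : ℕ) : ℚ) * p * phi2Hat b p x
      + (((q / p : ℕ) : ℚ) * p) ^ 2 * phi3Expl b p x)) ≤ (p : ℚ) ^ (-(3 : ℤ)) := by
  have hqx : q % p = x % p := (mem_filter.1 hq).2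
  obtain ⟨hqdec, ht⟩ := class_point_decomp b hx hq
  set t : ℚ := -(((q / p : ℕ) : ℚ) * p) with htdef
  have hcen : CentreIn b p q ↔ CentreIn b p x := centreIn_iff_of_mem hq
  set S := (range ((b 0).toNat + 1)).filter (fun s => s % p ≠ x % p) with hS
  have hunit : ∀ s ∈ S, padicNorm p ((s : ℚ) - x) = 1 := fun s hs => padicNorm_sub_eq_one_of_mod_ne (mem_filter.1 hs).2
  have hsq : ∀ s : ℕ, ((s : ℚ) - q) = ((s : ℚ) - x) + t := by intro s; rw [hqdec, htdef]; ring
  have hφq : phiHat b p q = (∑ s ∈ S, (netExp b s : ℚ) / ((s : ℚ) - q))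
      + (if ¬ (2 : ℤ) ∣ b 0 ∧ ¬ CentreIn b p q then 1 / (((b 0 : ℤ) : ℚ) / 2 - q) else 0) := by
    rw [phiHat, hS, hqx]
  have hφx : phiHat b p x = (∑ s ∈ S, (netExp b s : ℚ) / ((s : ℚ) - x))
      + (if ¬ (2 : ℤ) ∣ b 0 ∧ ¬ CentreIn b p x then 1 / (((b 0 : ℤ) : ℚ) / 2 - x) else 0) := rfl
  have hφ2x : phi2Hat b p x = (∑ s ∈ S, (netExp b s : ℚ) / ((s : ℚ) - x) ^ 2)
      + (if ¬ (2 : ℤ) ∣ b 0 ∧ ¬ CentreIn b p x then 1 / (((b 0 : ℤ) : ℚ) / 2 - x) ^ 2 else 0) := rfl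
  have hφ3x : phi3Expl b p x = (∑ s ∈ S, (netExp b s : ℚ) / ((s : ℚ) - x) ^ 3)
      + (if ¬ (2 : ℤ) ∣ b 0 ∧ ¬ CentreIn b p x then 1 / (((b 0 : ℤ) : ℚ) / 2 - x) ^ 3 else 0) := rfl
  have hℓt : ((q / p : ℕ) : ℚ) * p = -t := by rw [htdef, neg_neg]
  rw [hℓt]
  have e : phiHat b p q - (phiHat b p x + -t * phi2Hat b p x + (-t) ^ 2 * phi3Expl b p x) =
      (∑ s ∈ S, ((netExp b s : ℚ) / ((s : ℚ) - q)
          - ((netExp b s : ℚ) / ((s : ℚ) - x) - t * ((netExp b s : ℚ) / ((s : ℚ) - x) ^ 2)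
              + t ^ 2 * ((netExp b s : ℚ) / ((s : ℚ) - x) ^ 3))))
      + ((if ¬ (2 : ℤ) ∣ b 0 ∧ ¬ CentreIn b p q then 1 / (((b 0 : ℤ) : ℚ) / 2 - q) else 0)
          - ((if ¬ (2 : ℤ) ∣ b 0 ∧ ¬ CentreIn b p x then 1 / (((b 0 : ℤ) : ℚ) / 2 - x) else 0)
              - t * (if ¬ (2 : ℤ) ∣ b 0 ∧ ¬ CentreIn b p x then 1 / (((b 0 : ℤ) : ℚ) / 2 - x) ^ 2 else 0)
              + t ^ 2 * (if ¬ (2 : ℤ) ∣ b 0 ∧ ¬ CentreIn b p x then 1 / (((b 0 : ℤ) : ℚ) / 2 - x) ^ 3 else 0))) := by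
    rw [hφq, hφx, hφ2x, hφ3x, sum_sub_distrib, sum_add_distrib, sum_sub_distrib, ← mul_sum, ← mul_sum]; ring
  rw [e]
  refine (padicNorm.nonarchimedean (p := p)).trans (max_le ?_ ?_)
  · refine padicNorm.sum_le' (fun s hs => ?_) (zpow_p_nonneg _)
    rw [hsq s]
    exact padicNorm_div_add_sub_le₃ (padicNorm.of_int _) (hunit s hs) ht
  · by_cases h : ¬ (2 : ℤ) ∣ b 0 ∧ ¬ CentreIn b p q
    · have h' : ¬ (2 : ℤ) ∣ b 0 ∧ ¬ CentreIn b p x := ⟨h.1, fun hc => h.2 (hcen.2 hc)⟩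
      rw [if_pos h, if_pos h', if_pos h', if_pos h']
      have hc1 := padicNorm_centre_eq_one b hp2 h'.2
      have ec : (((b 0 : ℤ) : ℚ) / 2 - q) = (((b 0 : ℤ) : ℚ) / 2 - x) + t := by rw [hqdec, htdef]; ring
      rw [ec]
      exact padicNorm_div_add_sub_le₃ (by rw [padicNorm.one]) hc1 ht
    · have h' : ¬ (¬ (2 : ℤ) ∣ b 0 ∧ ¬ CentreIn b p x) := fun hc => h ⟨hc.1, fun hcc => hc.2 (hcen.1 hcc)⟩
      rw [if_neg h, if_neg h', if_neg h', if_neg h', mul_zero, mul_zero, sub_zero, add_zero, sub_self, padicNorm.zero]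
      exact zpow_p_nonneg _

/-! ### The cubic Taylor coefficient `c₃ = (φ³ − 3φφ₂ + 2φ₃)/6` is class-constant modulo `p` -/

/-- **`c₃` is class-constant modulo `p`** (`p ≥ 5`): with `c₃,y := (φ_y³ − 3φ_yφ₂,y + 2φ₃,y)/6` (the cubic coefficient of
`padicNorm_gHat_sub_fourth_le`), `‖c₃,q − c₃,x‖_p ≤ p⁻¹` for `q` in the class of `x < p`. -/
theorem padicNorm_cubicExpl_sub_le (b : ℕ → ℤ) (hp5 : 5 ≤ p) {x q : ℕ} (hx : x < p) (hq : q ∈ classSet b p x) :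
    padicNorm p ((phiHat b p q ^ 3 - 3 * phiHat b p q * phi2Hat b p q + 2 * phi3Expl b p q) / 6
      - (phiHat b p x ^ 3 - 3 * phiHat b p x * phi2Hat b p x + 2 * phi3Expl b p x) / 6) ≤ (p : ℚ) ^ (-(1 : ℤ)) := by
  have hp2 : p ≠ 2 := by omega
  have e : (phiHat b p q ^ 3 - 3 * phiHat b p q * phi2Hat b p q + 2 * phi3Expl b p q) / 6
      - (phiHat b p x ^ 3 - 3 * phiHat b p x * phi2Hat b p x + 2 * phi3Expl b p x) / 6
      = ((phiHat b p q ^ 2 + phiHat b p q * phiHat b p x + phiHat b p x ^ 2) * (phiHat b p q - phiHat b p x)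
          - 3 * (phi2Hat b p q * (phiHat b p q - phiHat b p x) + phiHat b p x * (phi2Hat b p q - phi2Hat b p x))
          + 2 * (phi3Expl b p q - phi3Expl b p x)) / 6 := by ring
  rw [e, padicNorm.div, padicNorm_six hp5, div_one]
  have hφq := padicNorm_phiHat_le_one b hp2 q
  have hφx := padicNorm_phiHat_le_one b hp2 x
  have hdφ := padicNorm_phiHat_sub_le b hp2 hq
  have hdφ2 := padicNorm_phi2Hat_sub_le b hp2 hx hq
  have hdφ3 := padicNorm_phi3Expl_sub_le b hp2 hx hq
  have hmul : ∀ {u v : ℚ}, padicNorm p u ≤ 1 → padicNorm p v ≤ (p : ℚ) ^ (-(1 : ℤ)) →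
      padicNorm p (u * v) ≤ (p : ℚ) ^ (-(1 : ℤ)) := by
    intro u v hu hv
    rw [padicNorm.mul]
    calc padicNorm p u * padicNorm p v ≤ 1 * (p : ℚ) ^ (-(1 : ℤ)) := mul_le_mul hu hv (padicNorm.nonneg _) zero_le_one
      _ = _ := one_mul _
  refine (padicNorm.nonarchimedean (p := p)).trans (max_le ((padicNorm.sub (p := p)).trans (max_le ?_ ?_)) ?_)
  · refine hmul ((padicNorm.nonarchimedean (p := p)).trans (max_le ((padicNorm.nonarchimedean (p := p)).trans
      (max_le ?_ ?_)) ?_)) hdφ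
    · rw [padicNorm_pow_eq]; exact pow_le_one₀ (padicNorm.nonneg _) hφq
    · rw [padicNorm.mul]
      calc _ ≤ (1 : ℚ) * 1 := mul_le_mul hφq hφx (padicNorm.nonneg _) zero_le_one
        _ = 1 := one_mul 1
    · rw [padicNorm_pow_eq]; exact pow_le_one₀ (padicNorm.nonneg _) hφx
  · refine hmul (by simpa using padicNorm.of_int (p := p) 3) ((padicNorm.nonarchimedean (p := p)).trans (max_le ?_ ?_))
    · exact hmul (padicNorm_phi2Hat_le_one b hp2 q) hdφ
    · exact hmul hφx hdφ2
  · exact hmul (by simpa using padicNorm.of_int (p := p) 2) hdφ3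

end Summit.KontsevichZagierPeriods.Zeta5Search.SecondOrder

end
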